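/-
Copyright (c) 2026 the pub-hodgecm-mathlib formalisation cell (harness21).  Prover seat hodgecm-mathlib-K2E5-p15 (g3), HCML Track B «K2-LIT»,
h413 = `stmt-HodgeConjecture-24833`, (SC-an) line (lead K2E3-p14 (g3)), road «HC-14-ell», file E4 «THE `𝔲(2)` BASE CASE» — STRUCTURE FILE A′
(dealer K2E3-plan (g2) deal (D45); lead RULINGS #7 (R7-1)∕(R7-2)).  2026-09-04.
-/
import Summits.HodgeConjecture.HodgeConjecture.Theorems.K2E3HC14EllU11Orbit   -- FILE A (this seat): orbit formulas, `lie_relations_two`, `conj_mem_lie`, `centralizerSet_conj_eq`; brings the ★ `LineRing` kit and ★ `normAbs`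
import HarnessLib

/-!
# h413 ∕ Track B «K2-LIT», road «HC-14-ell», file E4 — STRUCTURE FILE A′: A REGULAR ELLIPTIC `Y ∈ 𝔲(σ, Φ₂)(K)` HAS NO ISOTROPIC EIGENVECTOR
# (`y₁₀ ≠ 0`, `y₀₁ ≠ 0`, and `χ_Y(y₁₁ + w·y₁₀) ≠ 0` for every `w ∈ K⁻`), over a non-archimedean local field `K`

Cell `pub/hodgecm-mathlib`, crux H413 = `stmt-HodgeConjecture-24833` (lane `--supports … --as helper`, count-neutral); seat K2E5-p15 (g3); dealer K2E3-plan (g2)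
deal (D45); (SC-an) line lead K2E3-p14 (g3) (RULINGS #7).  THEOREMS ONLY (no `def`, no `instance`, no `notation`, no named-fact hypothesis, no `sorry`); never
imports `Cruxes/…/Lines`.  Second structure file behind §2 (E4-iso) of `Theorems/K2E3HC14EllBaseCaseU2.lean` (HC Thm 13 for the compact Cartans of `𝔲(1,1)`).

THE MATHEMATICS ([HarishChandra1970, Part V §3]; [Rogawski1990, §3.6]; [PlatonovRapinchuk1994, §3.5]).  `K` a non-archimedean local field, `σ` an involution of `K`,
`J = Φ₂`, `U = U(σ, Φ₂)(K)`.  The diagonal torus `T₂ = {diag(α, σ(α)⁻¹)}` is closed (★ `isClosed_torusU_two`) and lies in NO compact subset of `U`: it contains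
`diag(ϖ^{−k}, σ(ϖ)^{k})` with `|ϖ^{−k}|_K = q^k → ∞` (§1).  Let `Y ∈ 𝔲(σ, Φ₂)` (matrix currency `ᵗ(σY)Φ₂ + Φ₂Y = 0`) be REGULAR (`disc χ_Y ≠ 0`) and ELLIPTIC (the centraliser
set `{g ∈ U | g Y g⁻¹ = Y}` is compact).  §2: **`y₁₀ ≠ 0`** — otherwise `Y = [[ξ, q],[0, η]]` with `η − ξ ≠ 0` `σ`-fixed and `σq = −q` (FILE A `lie_relations_two`), the unitary
`n_x = [[1, x],[0, 1]]`, `x = q∕(η − ξ) ∈ K⁻` (★ `exists_lineChart`) has `n_x⁻¹ Y n_x = diag(ξ, η)` (FILE A `conj_unipotent_apply`), so `n_x T₂ n_x⁻¹` centralises `Y` and `T₂` would sit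
in a compact set; **`y₀₁ ≠ 0`** — apply the former to `w₀⁻¹ Y w₀`, `w₀ = Φ₂ ∈ U` the Weyl element (regular elliptic again: FILE A `conj_mem_lie`, Mathlib `Matrix.discr_conj'`,
FILE A `centralizerSet_conj_eq`); §3: **`χ_Y(y₁₁ + w·y₁₀) ≠ 0` for every `w ∈ K⁻`** — for `Z = n_w⁻¹ Y n_w` one has `Z₁₀ = y₁₀ ≠ 0`, `Z₁₁ = y₁₁ + w y₁₀` and
`Z₀₁ Z₁₀ = −χ_Y(Z₁₁)` (FILE A), while `Z₀₁ ≠ 0` by §2 applied to the regular elliptic `Z`.  These are the two facts through which ellipticity enters the volume estimate of the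
head file (`y₁₀ ≠ 0` bounds the torus levels from one side, the zero-free line bounds them from the other).

## References
* [HarishChandra1970] Harish-Chandra (notes by G. van Dijk), *Harmonic Analysis on Reductive p-adic Groups*, LNM 162 (1970), Part V §3 Thm. 13 p. 51; Part VI §8 Thm. 14.
* [Rogawski1990] J. D. Rogawski, *Automorphic Representations of Unitary Groups in Three Variables*, Ann. of Math. Stud. 123 (1990), §1.10 p. 9; §3.6 pp. 28–31.
* [PlatonovRapinchuk1994] V. Platonov, A. Rapinchuk, *Algebraic Groups and Number Theory* (1994), §3.5.
-/

set_option autoImplicit false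
set_option linter.dupNamespace false  -- the mandated namespace repeats the single-problem summit's segment (`HodgeConjecture.HodgeConjecture`)

noncomputable section

open Matrix Set Filter Topology
open scoped MatrixGroups NNReal
open Literature.NumberTheory.Automorphic Literature.NumberTheory.Automorphic.UnitaryGroup Literature.NumberTheory.Automorphic.UnitaryGroup.HeisRing
open Literature.NumberTheory.Automorphic.UnitaryGroup.LineRing
open Literature.NumberTheory.GaloisRepresentations Literature.NumberTheory.GaloisRepresentations.IsNonarchimedeanLocalField
open Summit.HodgeConjecture.HodgeConjecture.Cruxes.H413.K2E3HC14EllU11Orbit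

namespace Summit.HodgeConjecture.HodgeConjecture.Cruxes.H413.K2E3HC14EllU11Elliptic

variable {K : Type*} [Field K] [ValuativeRel K] [TopologicalSpace K] [IsNonarchimedeanLocalField K]
  (σ : K →+* K) (hσ : ∀ x, σ (σ x) = x) {J : Matrix (Fin 2) (Fin 2) K} (hJ : J = (StdForm.antidiagonal 2).over K)

/-! ## §1 The diagonal torus is not relatively compact; the Weyl element; conjugates of regular elliptic elements -/

omit [ValuativeRel K] [TopologicalSpace K] [IsNonarchimedeanLocalField K] in
include hσ hJ in
/-- `t_α = diag(α, σ(α)⁻¹) ∈ U(σ, Φ₂)(K)` for every unit `α` (★ `glDiagonal_mem_unitaryGroupOfForm_antidiagonal_iff`). [cite: Rogawski1990, §1.10 p. 9] -/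
theorem glDiagonal_pair_mem (α : Kˣ) :
    glDiagonal 2 K ![α, (Units.map (σ : K →* K) α)⁻¹] ∈ unitaryGroupOfForm σ J := by
  rw [hJ, glDiagonal_mem_unitaryGroupOfForm_antidiagonal_iff]
  intro i
  fin_cases i
  · show σ ((![α, (Units.map (σ : K →* K) α)⁻¹] (Fin.rev 0) : Kˣ) : K) * ((![α, (Units.map (σ : K →* K) α)⁻¹] 0 : Kˣ) : K) = 1
    simp only [show (Fin.rev 0 : Fin 2) = 1 from rfl, Matrix.cons_val_one, Matrix.cons_val_fin_one, Matrix.cons_val_zero, Units.val_inv_eq_inv_val,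
      Units.coe_map, MonoidHom.coe_coe, map_inv₀, hσ]
    exact inv_mul_cancel₀ α.ne_zero
  · show σ ((![α, (Units.map (σ : K →* K) α)⁻¹] (Fin.rev 1) : Kˣ) : K) * ((![α, (Units.map (σ : K →* K) α)⁻¹] 1 : Kˣ) : K) = 1
    simp only [show (Fin.rev 1 : Fin 2) = 0 from rfl, Matrix.cons_val_one, Matrix.cons_val_fin_one, Matrix.cons_val_zero, Units.val_inv_eq_inv_val,
      Units.coe_map, MonoidHom.coe_coe]
    exact mul_inv_cancel₀ ((map_ne_zero σ).2 α.ne_zero)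

include hσ hJ in
/-- **The diagonal torus `T₂ ≤ U(σ, Φ₂)(K)` is contained in no compact set**: it contains `diag(ϖ^{-k}, σ(ϖ)^{k})` for all `k`, whose `(0,0)` entry has
`|·|_K = q^k → ∞` (★ `exists_normAbs_eq_inv`, `q > 1`), while `g ↦ |g₀₀|_K` is continuous on `U` and hence bounded on compacta. [cite: PlatonovRapinchuk1994, §3.5] -/
theorem not_subset_isCompact_torusU_two {C : Set ↥(unitaryGroupOfForm σ J)} (hC : IsCompact C) : ¬ ((torusU σ J : Set ↥(unitaryGroupOfForm σ J)) ⊆ C) := by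
  intro hsub
  have hcont : Continuous fun g : ↥(unitaryGroupOfForm σ J) => normAbs K (((g : GL (Fin 2) K) : Matrix (Fin 2) (Fin 2) K) 0 0) :=
    LocalFieldHaar.continuous_normAbs.comp ((Units.continuous_val.comp continuous_subtype_val).matrix_elem 0 0)
  obtain ⟨B, hB⟩ := hC.bddAbove_image hcont.continuousOn
  obtain ⟨ϖ, hϖ0, hϖ⟩ := exists_normAbs_eq_inv (F := K)
  have hq : 1 < (residueFieldCard K : ℝ≥0) := by exact_mod_cast one_lt_residueFieldCard K
  obtain ⟨k, hk⟩ := pow_unbounded_of_one_lt B hq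
  set α : Kˣ := (Units.mk0 ϖ hϖ0)⁻¹ ^ k with hα
  set t : ↥(unitaryGroupOfForm σ J) := ⟨glDiagonal 2 K ![α, (Units.map (σ : K →* K) α)⁻¹], glDiagonal_pair_mem σ hσ hJ α⟩ with ht
  have htT : t ∈ torusU σ J := (mem_torusU_iff t).2 ⟨_, rfl⟩
  have hval : normAbs K (((t : GL (Fin 2) K) : Matrix (Fin 2) (Fin 2) K) 0 0) = (residueFieldCard K : ℝ≥0) ^ k := by
    change normAbs K ((glDiagonal 2 K ![α, (Units.map (σ : K →* K) α)⁻¹] : Matrix (Fin 2) (Fin 2) K) 0 0) = _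
    rw [coe_glDiagonal, Matrix.diagonal_apply_eq, Matrix.cons_val_zero, hα, Units.val_pow_eq_pow_val, Units.val_inv_eq_inv_val, Units.val_mk0, map_pow, map_inv₀, hϖ,
      inv_inv]
  have hle := hB ⟨t, hsub htT, rfl⟩
  simp only [hval] at hle
  exact not_lt.2 hle hk

omit [ValuativeRel K] [TopologicalSpace K] [IsNonarchimedeanLocalField K] in
include hJ in
/-- **The Weyl element `w₀ = [[0,1],[1,0]] = Φ₂` lies in `U(σ, Φ₂)`** (`σ` fixes `0, 1`; `w₀ Φ₂ w₀ = Φ₂`). [cite: Rogawski1990, §3.6 pp. 28–31] -/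
theorem weyl_mem :
    (⟨!![(0 : K), 1; 1, 0], !![(0 : K), 1; 1, 0], by simp [Matrix.one_fin_two], by simp [Matrix.one_fin_two]⟩ : GL (Fin 2) K) ∈
      unitaryGroupOfForm σ J := by
  rw [mem_unitaryGroupOfForm_iff, hJ, antidiagonal_two_over_eq]
  have hmap : (!![(0 : K), 1; 1, 0]).map σ = !![(0 : K), 1; 1, 0] := by
    ext i j; fin_cases i <;> fin_cases j <;> simp
  have htr : (!![(0 : K), 1; 1, 0])ᵀ = !![(0 : K), 1; 1, 0] := by
    ext i j; fin_cases i <;> fin_cases j <;> rfl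
  change ((!![(0 : K), 1; 1, 0]).map σ)ᵀ * !![(0 : K), 1; 1, 0] * !![(0 : K), 1; 1, 0] = !![(0 : K), 1; 1, 0]
  rw [hmap, htr]
  ext i j; fin_cases i <;> fin_cases j <;> simp

omit [ValuativeRel K] [TopologicalSpace K] [IsNonarchimedeanLocalField K] in
/-- **Conjugates of regular elements are regular** (Mathlib `Matrix.discr_conj'`). [cite: Rogawski1990, §3.6 pp. 28–31] -/
theorem charpoly_discr_conj_ne_zero {J' : Matrix (Fin 2) (Fin 2) K} (u : ↥(unitaryGroupOfForm σ J')) {Y : Matrix (Fin 2) (Fin 2) K} (hYreg : (Matrix.charpoly Y).discr ≠ 0) :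
    (Matrix.charpoly ((((u : GL (Fin 2) K)⁻¹ : GL (Fin 2) K) : Matrix (Fin 2) (Fin 2) K) * Y * ((u : GL (Fin 2) K) : Matrix (Fin 2) (Fin 2) K))).discr ≠ 0 := by
  have h : ((((u : GL (Fin 2) K)⁻¹ : GL (Fin 2) K) : Matrix (Fin 2) (Fin 2) K) * Y * ((u : GL (Fin 2) K) : Matrix (Fin 2) (Fin 2) K)).discr = Y.discr := by
    rw [Matrix.coe_units_inv]; exact Matrix.discr_conj' (u : GL (Fin 2) K) Y
  rw [Matrix.discr, Matrix.discr] at h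
  rwa [h]

/-- **Conjugates of elliptic elements are elliptic**: the centraliser set of `u⁻¹ Y u` is the continuous image of that of `Y` (FILE A `centralizerSet_conj_eq`).
[cite: PlatonovRapinchuk1994, §3.5] -/
theorem isCompact_centralizerSet_conj {J' : Matrix (Fin 2) (Fin 2) K} (u : ↥(unitaryGroupOfForm σ J')) {Y : Matrix (Fin 2) (Fin 2) K}
    (hYell : IsCompact {g : ↥(unitaryGroupOfForm σ J') |
      ((g : GL (Fin 2) K) : Matrix (Fin 2) (Fin 2) K) * Y * (((g : GL (Fin 2) K)⁻¹ : GL (Fin 2) K) : Matrix (Fin 2) (Fin 2) K) = Y}) :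
    IsCompact {g : ↥(unitaryGroupOfForm σ J') | ((g : GL (Fin 2) K) : Matrix (Fin 2) (Fin 2) K) *
        ((((u : GL (Fin 2) K)⁻¹ : GL (Fin 2) K) : Matrix (Fin 2) (Fin 2) K) * Y * ((u : GL (Fin 2) K) : Matrix (Fin 2) (Fin 2) K)) * (((g : GL (Fin 2) K)⁻¹ : GL (Fin 2) K) : Matrix (Fin 2) (Fin 2) K) =
        (((u : GL (Fin 2) K)⁻¹ : GL (Fin 2) K) : Matrix (Fin 2) (Fin 2) K) * Y * ((u : GL (Fin 2) K) : Matrix (Fin 2) (Fin 2) K)} := by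
  rw [centralizerSet_conj_eq σ J' u Y]
  exact hYell.image ((continuous_const.mul continuous_id).mul continuous_const)

/-! ## §2 Regular elliptic ⇒ `y₁₀ ≠ 0` and `y₀₁ ≠ 0` -/

include hσ hJ in
/-- **A REGULAR ELLIPTIC `Y ∈ 𝔲(σ, Φ₂)(K)` HAS `y₁₀ ≠ 0`** (the isotropic vector `e₀` is not an eigenvector).  If `y₁₀ = 0` then `Y = [[ξ, q], [0, η]]` with `η = −σξ`,
`σq = −q`, `η ≠ ξ` (`disc χ_Y = (ξ − η)²`), `σ(η − ξ) = η − ξ`; the unitary `n_x`, `x = q∕(η − ξ) ∈ K⁻` (★ `exists_lineChart`), conjugates `Y` to `diag(ξ, η)` (FILE A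
`conj_unipotent_apply`); then `n_x T₂ n_x⁻¹` centralises `Y`, so the torus `T₂` would lie in the compact set `n_x⁻¹·{g | gYg⁻¹ = Y}·n_x` — impossible (§1).
[cite: HarishChandra1970, Part V §3 Thm. 13 p. 51] [cite: Rogawski1990, §3.6 pp. 28–31] [cite: PlatonovRapinchuk1994, §3.5] -/
theorem apply_one_zero_ne_zero_of_isCompact_centralizer {Y : Matrix (Fin 2) (Fin 2) K} (hY : (Y.map σ)ᵀ * J + J * Y = 0) (hYreg : (Matrix.charpoly Y).discr ≠ 0)
    (hYell : IsCompact {g : ↥(unitaryGroupOfForm σ J) |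
      ((g : GL (Fin 2) K) : Matrix (Fin 2) (Fin 2) K) * Y * (((g : GL (Fin 2) K)⁻¹ : GL (Fin 2) K) : Matrix (Fin 2) (Fin 2) K) = Y}) :
    Y 1 0 ≠ 0 := by
  intro h10
  obtain ⟨-, hq, h11, h00⟩ := lie_relations_two σ hJ hY
  -- regularity: `η − ξ ≠ 0`, and it is `σ`-fixed
  have hdisc : (Matrix.charpoly Y).discr = (Y 0 0 - Y 1 1) ^ 2 := by
    have h := Matrix.discr_fin_two Y
    rw [Matrix.discr] at h
    rw [h, Matrix.trace_fin_two, Matrix.det_fin_two, h10]; ring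
  have hs : Y 1 1 - Y 0 0 ≠ 0 := by
    intro h; apply hYreg
    rw [hdisc, show Y 0 0 - Y 1 1 = -(Y 1 1 - Y 0 0) by ring, h]; ring
  have hσ00 : σ (Y 0 0) = -Y 1 1 := by rw [h11, neg_neg]
  have hσ11 : σ (Y 1 1) = -Y 0 0 := by rw [h00, neg_neg]
  have hsσ : σ (Y 1 1 - Y 0 0) = Y 1 1 - Y 0 0 := by rw [map_sub, hσ11, hσ00]; ring
  -- `x = q∕(η − ξ) ∈ K⁻` and the unitary `n_x`
  set x : K := Y 0 1 / (Y 1 1 - Y 0 0) with hx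
  have hxskew : x ∈ skewPart σ := by
    rw [mem_skewPart_iff, hx, map_div₀, hq, hsσ, neg_div]
  obtain ⟨e, he, -⟩ := exists_lineChart σ hJ
  set n : ↥(unipotentU σ J) := e ⟨x, hxskew⟩ with hn
  have hn01 : (((n : ↥(unitaryGroupOfForm σ J)) : GL (Fin 2) K) : Matrix (Fin 2) (Fin 2) K) 0 1 = x := he ⟨x, hxskew⟩
  -- `n⁻¹ Y n = diag(ξ, η)`
  obtain ⟨hZ00, hZ01, hZ10, hZ11⟩ := conj_unipotent_apply σ n Y (g := ((n : ↥(unitaryGroupOfForm σ J)) : GL (Fin 2) K)) rfl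
  rw [hn01, h10] at hZ00 hZ01 hZ11
  rw [h10] at hZ10
  have hxs : x * (Y 1 1 - Y 0 0) = Y 0 1 := by rw [hx]; exact div_mul_cancel₀ _ hs
  have hZ00' : (((((n : ↥(unitaryGroupOfForm σ J)) : GL (Fin 2) K)⁻¹ : GL (Fin 2) K) : Matrix (Fin 2) (Fin 2) K) * Y *
      (((n : ↥(unitaryGroupOfForm σ J)) : GL (Fin 2) K) : Matrix (Fin 2) (Fin 2) K)) 0 0 = Y 0 0 := by rw [hZ00]; ring
  have hZ01' : (((((n : ↥(unitaryGroupOfForm σ J)) : GL (Fin 2) K)⁻¹ : GL (Fin 2) K) : Matrix (Fin 2) (Fin 2) K) * Y *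
      (((n : ↥(unitaryGroupOfForm σ J)) : GL (Fin 2) K) : Matrix (Fin 2) (Fin 2) K)) 0 1 = 0 := by rw [hZ01]; linear_combination -hxs
  have hZ11' : (((((n : ↥(unitaryGroupOfForm σ J)) : GL (Fin 2) K)⁻¹ : GL (Fin 2) K) : Matrix (Fin 2) (Fin 2) K) * Y *
      (((n : ↥(unitaryGroupOfForm σ J)) : GL (Fin 2) K) : Matrix (Fin 2) (Fin 2) K)) 1 1 = Y 1 1 := by rw [hZ11]; ring
  have hZ : ((((n : ↥(unitaryGroupOfForm σ J)) : GL (Fin 2) K)⁻¹ : GL (Fin 2) K) : Matrix (Fin 2) (Fin 2) K) * Y *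
      (((n : ↥(unitaryGroupOfForm σ J)) : GL (Fin 2) K) : Matrix (Fin 2) (Fin 2) K) = !![Y 0 0, 0; 0, Y 1 1] := by
    rw [Matrix.eta_fin_two (((((n : ↥(unitaryGroupOfForm σ J)) : GL (Fin 2) K)⁻¹ : GL (Fin 2) K) : Matrix (Fin 2) (Fin 2) K) * Y *
      (((n : ↥(unitaryGroupOfForm σ J)) : GL (Fin 2) K) : Matrix (Fin 2) (Fin 2) K)), hZ00', hZ01', hZ10, hZ11']
  -- the torus sits inside the compact `n⁻¹ · Z(Y) · n`
  have hC' : IsCompact ((fun g : ↥(unitaryGroupOfForm σ J) => ((n : ↥(unitaryGroupOfForm σ J)))⁻¹ * g * (n : ↥(unitaryGroupOfForm σ J))) ''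
      {g : ↥(unitaryGroupOfForm σ J) | ((g : GL (Fin 2) K) : Matrix (Fin 2) (Fin 2) K) * Y * (((g : GL (Fin 2) K)⁻¹ : GL (Fin 2) K) : Matrix (Fin 2) (Fin 2) K) = Y}) :=
    hYell.image ((continuous_const.mul continuous_id).mul continuous_const)
  refine not_subset_isCompact_torusU_two σ hσ hJ hC' fun t ht => ?_
  obtain ⟨d, hd⟩ := (mem_torusU_iff t).1 ht
  refine ⟨(n : ↥(unitaryGroupOfForm σ J)) * t * ((n : ↥(unitaryGroupOfForm σ J)))⁻¹, ?_, by group⟩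
  -- matrices
  set N : GL (Fin 2) K := ((n : ↥(unitaryGroupOfForm σ J)) : GL (Fin 2) K) with hN
  set T : GL (Fin 2) K := (t : GL (Fin 2) K) with hT
  have hTd : (T : Matrix (Fin 2) (Fin 2) K) = !![(d 0 : K), 0; 0, (d 1 : K)] := by
    rw [hT, coe_torus_eq_diagonal σ hd]; ext i j; fin_cases i <;> fin_cases j <;> simp
  have hTid : ((T⁻¹ : GL (Fin 2) K) : Matrix (Fin 2) (Fin 2) K) = !![(d 0 : K)⁻¹, 0; 0, (d 1 : K)⁻¹] := by
    rw [hT, coe_torus_inv_eq_diagonal σ hd]; ext i j; fin_cases i <;> fin_cases j <;> simp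
  have hTD : (T : Matrix (Fin 2) (Fin 2) K) * !![Y 0 0, 0; 0, Y 1 1] * ((T⁻¹ : GL (Fin 2) K) : Matrix (Fin 2) (Fin 2) K) = !![Y 0 0, 0; 0, Y 1 1] := by
    have h0 : (d 0 : K) ≠ 0 := (d 0).ne_zero
    have h1 : (d 1 : K) ≠ 0 := (d 1).ne_zero
    rw [hTd, hTid]
    ext i j; fin_cases i <;> fin_cases j <;> simp <;> field_simp
  have hNN : (N : Matrix (Fin 2) (Fin 2) K) * ((N⁻¹ : GL (Fin 2) K) : Matrix (Fin 2) (Fin 2) K) = 1 := by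
    rw [← Units.val_mul, mul_inv_cancel, Units.val_one]
  have hYN : Y = (N : Matrix (Fin 2) (Fin 2) K) * !![Y 0 0, 0; 0, Y 1 1] * ((N⁻¹ : GL (Fin 2) K) : Matrix (Fin 2) (Fin 2) K) := by
    rw [← hZ]
    calc Y = ((N : Matrix (Fin 2) (Fin 2) K) * ((N⁻¹ : GL (Fin 2) K) : Matrix (Fin 2) (Fin 2) K)) * Y * ((N : Matrix (Fin 2) (Fin 2) K) * ((N⁻¹ : GL (Fin 2) K) : Matrix (Fin 2) (Fin 2) K)) := by
          rw [hNN, Matrix.one_mul, Matrix.mul_one]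
      _ = (N : Matrix (Fin 2) (Fin 2) K) * (((N⁻¹ : GL (Fin 2) K) : Matrix (Fin 2) (Fin 2) K) * Y * N) * ((N⁻¹ : GL (Fin 2) K) : Matrix (Fin 2) (Fin 2) K) := by
          simp only [Matrix.mul_assoc]
  show ((((n : ↥(unitaryGroupOfForm σ J)) * t * ((n : ↥(unitaryGroupOfForm σ J)))⁻¹ : ↥(unitaryGroupOfForm σ J)) : GL (Fin 2) K) : Matrix (Fin 2) (Fin 2) K) * Y *
      (((((n : ↥(unitaryGroupOfForm σ J)) * t * ((n : ↥(unitaryGroupOfForm σ J)))⁻¹ : ↥(unitaryGroupOfForm σ J)) : GL (Fin 2) K)⁻¹ : GL (Fin 2) K) : Matrix (Fin 2) (Fin 2) K) = Y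
  rw [Subgroup.coe_mul, Subgroup.coe_mul, Subgroup.coe_inv, _root_.mul_inv_rev, _root_.mul_inv_rev, inv_inv, ← hN, ← hT, Units.val_mul, Units.val_mul, Units.val_mul,
    Units.val_mul]
  calc (N : Matrix (Fin 2) (Fin 2) K) * T * ((N⁻¹ : GL (Fin 2) K) : Matrix (Fin 2) (Fin 2) K) * Y *
        ((N : Matrix (Fin 2) (Fin 2) K) * (((T⁻¹ : GL (Fin 2) K) : Matrix (Fin 2) (Fin 2) K) * ((N⁻¹ : GL (Fin 2) K) : Matrix (Fin 2) (Fin 2) K)))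
      = (N : Matrix (Fin 2) (Fin 2) K) * T * (((N⁻¹ : GL (Fin 2) K) : Matrix (Fin 2) (Fin 2) K) * Y * N) * ((T⁻¹ : GL (Fin 2) K) : Matrix (Fin 2) (Fin 2) K) *
          ((N⁻¹ : GL (Fin 2) K) : Matrix (Fin 2) (Fin 2) K) := by simp only [Matrix.mul_assoc]
    _ = (N : Matrix (Fin 2) (Fin 2) K) * ((T : Matrix (Fin 2) (Fin 2) K) * !![Y 0 0, 0; 0, Y 1 1] * ((T⁻¹ : GL (Fin 2) K) : Matrix (Fin 2) (Fin 2) K)) *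
          ((N⁻¹ : GL (Fin 2) K) : Matrix (Fin 2) (Fin 2) K) := by rw [hZ]; simp only [Matrix.mul_assoc]
    _ = Y := by rw [hTD, ← hYN]

include hσ hJ in
/-- **A REGULAR ELLIPTIC `Y ∈ 𝔲(σ, Φ₂)(K)` HAS `y₀₁ ≠ 0`** — the previous statement for the conjugate `w₀⁻¹ Y w₀` by the Weyl element `w₀ = Φ₂ ∈ U` (`(w₀⁻¹ Y w₀)₁₀ = y₀₁`),
which is again in `𝔲`, regular and elliptic (FILE A `conj_mem_lie`, Mathlib `Matrix.discr_conj'`, FILE A `centralizerSet_conj_eq`). [cite: HarishChandra1970, Part V §3 Thm. 13 p. 51]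
[cite: Rogawski1990, §3.6 pp. 28–31] -/
theorem apply_zero_one_ne_zero_of_isCompact_centralizer {Y : Matrix (Fin 2) (Fin 2) K} (hY : (Y.map σ)ᵀ * J + J * Y = 0) (hYreg : (Matrix.charpoly Y).discr ≠ 0)
    (hYell : IsCompact {g : ↥(unitaryGroupOfForm σ J) |
      ((g : GL (Fin 2) K) : Matrix (Fin 2) (Fin 2) K) * Y * (((g : GL (Fin 2) K)⁻¹ : GL (Fin 2) K) : Matrix (Fin 2) (Fin 2) K) = Y}) :
    Y 0 1 ≠ 0 := by
  set w : ↥(unitaryGroupOfForm σ J) := ⟨_, weyl_mem σ hJ⟩ with hw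
  have h := apply_one_zero_ne_zero_of_isCompact_centralizer σ hσ hJ (conj_mem_lie σ J w hY) (charpoly_discr_conj_ne_zero σ w hYreg) (isCompact_centralizerSet_conj σ w hYell)
  have hval : (((w : GL (Fin 2) K)⁻¹ : GL (Fin 2) K) : Matrix (Fin 2) (Fin 2) K) = !![(0 : K), 1; 1, 0] := rfl
  have hval' : ((w : GL (Fin 2) K) : Matrix (Fin 2) (Fin 2) K) = !![(0 : K), 1; 1, 0] := rfl
  rw [hval, hval', Matrix.eta_fin_two Y] at h
  simpa [Matrix.mul_fin_two] using h

/-! ## §3 The characteristic polynomial has no zero on the line `y₁₁ + K⁻·y₁₀` -/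

include hσ hJ in
/-- **`χ_Y(y₁₁ + w·y₁₀) ≠ 0` FOR EVERY `w ∈ K⁻`**, `χ_Y(z) = z² − (tr Y) z + det Y`, for a regular elliptic `Y ∈ 𝔲(σ, Φ₂)(K)`: with `n_w` the unitary unipotent of ★
`exists_lineChart`, `Z = n_w⁻¹ Y n_w` is in `𝔲`, regular and elliptic, has `Z₁₀ = y₁₀ ≠ 0`, `Z₀₁ ≠ 0` (§2) and `Z₁₁ = y₁₁ + w·y₁₀`, `Z₀₁ Z₁₀ = −χ_Y(Z₁₁)` (FILE A). (A zero
would make `n_w e₁` an ISOTROPIC eigenvector of `Y`.) [cite: HarishChandra1970, Part V §3 Thm. 13 p. 51] [cite: Rogawski1990, §3.6 pp. 28–31] -/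
theorem charpoly_eval_line_ne_zero {Y : Matrix (Fin 2) (Fin 2) K} (hY : (Y.map σ)ᵀ * J + J * Y = 0) (hYreg : (Matrix.charpoly Y).discr ≠ 0)
    (hYell : IsCompact {g : ↥(unitaryGroupOfForm σ J) |
      ((g : GL (Fin 2) K) : Matrix (Fin 2) (Fin 2) K) * Y * (((g : GL (Fin 2) K)⁻¹ : GL (Fin 2) K) : Matrix (Fin 2) (Fin 2) K) = Y})
    {w : K} (hw : σ w = -w) :
    (Y 1 1 + w * Y 1 0) ^ 2 - Matrix.trace Y * (Y 1 1 + w * Y 1 0) + Y.det ≠ 0 := by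
  obtain ⟨e, he, -⟩ := exists_lineChart σ hJ
  set n : ↥(unipotentU σ J) := e ⟨w, (mem_skewPart_iff σ w).2 hw⟩ with hn
  have hn01 : (((n : ↥(unitaryGroupOfForm σ J)) : GL (Fin 2) K) : Matrix (Fin 2) (Fin 2) K) 0 1 = w := he ⟨w, _⟩
  set u : ↥(unitaryGroupOfForm σ J) := (n : ↥(unitaryGroupOfForm σ J)) with hu
  obtain ⟨-, -, hZ10, hZ11⟩ := conj_unipotent_apply σ n Y (g := (u : GL (Fin 2) K)) rfl
  rw [hn01] at hZ11
  have h01 := apply_zero_one_ne_zero_of_isCompact_centralizer σ hσ hJ (conj_mem_lie σ J u hY) (charpoly_discr_conj_ne_zero σ u hYreg) (isCompact_centralizerSet_conj σ u hYell)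
  have h10 : ((((u : GL (Fin 2) K)⁻¹ : GL (Fin 2) K) : Matrix (Fin 2) (Fin 2) K) * Y * ((u : GL (Fin 2) K) : Matrix (Fin 2) (Fin 2) K)) 1 0 ≠ 0 := by
    rw [hZ10]; exact apply_one_zero_ne_zero_of_isCompact_centralizer σ hσ hJ hY hYreg hYell
  have hprod := conj_apply_zero_one_mul_apply_one_zero (u : GL (Fin 2) K) Y
  rw [hZ11] at hprod
  intro hzero
  have : Y 1 1 + w * Y 1 0 = Y 1 0 * w + Y 1 1 := by ring
  rw [this] at hzero
  rw [hzero, neg_zero] at hprod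
  rcases mul_eq_zero.1 hprod with h | h
  · exact h01 h
  · exact h10 h

end Summit.HodgeConjecture.HodgeConjecture.Cruxes.H413.K2E3HC14EllU11Elliptic

end
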